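import Literature.NumberTheory.EllipticCurves.DivisionValuesRootsOfUnity
import Literature.NumberTheory.EllipticCurves.WeierstrassPMultiplication
import HarnessLib

/-!
# The field of `q`-division values: two generators and the degree bound `≤ 4(q² - 1)²`

Topic `NumberTheory/EllipticCurves`; continuation of `DivisionValuesRootsOfUnity.lean`.
For a lattice `Λ = ℤω₁ + ℤω₂` and a field `F` of characteristic `0` with `F → ℂ` carrying a
Weierstrass model `E/F` of `E_Λ` (e.g. a subfield of `ℂ` containing `g₂(Λ), g₃(Λ)`):

* `adjoin_divisionValues_eq` — the field generated over `F` by all the `q`-division values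
  `℘(w), ℘'(w)/2` (`w ∈ (1/q)Λ ∖ Λ`) is generated by the four numbers
  `℘(ω₁/q), ℘'(ω₁/q)/2, ℘(ω₂/q), ℘'(ω₂/q)/2`: every `q`-division point is `aP + bQ` with
  `P = π(ω₁/q)`, `Q = π(ω₂/q)`, and the group law has coefficients in `F` (Silverman, *AEC* III.2.3:
  `E(K)` is a subgroup; here `K = F(P, Q)`).
* `finrank_adjoin_divisionValues_le` — hence `[F(E_Λ[q]) : F] ≤ (2(q² - 1))² ≤ 4q⁴`:
  `℘(ωᵢ/q)` is a root of `ψ_q² ∈ F[X]` of degree `q² - 1` (tree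
  `PeriodPair.aeval_weierstrassP_ΨSq_eq_zero`, Mathlib `WeierstrassCurve.natDegree_ΨSq`) and
  `℘'(ωᵢ/q)/2` is quadratic over `F(℘(ωᵢ/q))` (the Weierstrass equation).

Together with `exp_two_pi_I_div_mem_adjoin_divisionValues` (`e^{2πi/q} ∈ F(E_Λ[q])`) this is
the degree estimate "at most `c q⁴`" for the field of `q`-division values and `q`-th roots of
unity used in the Baker–Coates–Masser extrapolation on division points (Baker, *Transcendental
Number Theory*, p. 62; Masser, *Elliptic Functions and Transcendence*, Lemma 2.7 / Lemma 5.2).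

Everything here is proved; no named facts.

## References

* J. H. Silverman, *The Arithmetic of Elliptic Curves*, 2nd ed., GTM 106 (2009), III.2.3,
  Exercise 3.7, III.8 Cor. 8.1.1. [SilvermanAEC2009]
* A. Baker, *Transcendental Number Theory*, Cambridge 1975, Ch. 6 §6, p. 62. [Baker1975]
* D. W. Masser, *Elliptic Functions and Transcendence*, LNM 437 (1975), Lemma 2.7. [Masser1975]
-/

noncomputable section

open scoped Classical
open WeierstrassCurve PeriodPair Complex Polynomial IntermediateField

namespace Literature.NumberTheory.EllipticCurves

/-! ### `ωᵢ/q` are `q`-division points -/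

/-- `ω₁/q ∉ Λ` for `q ≥ 2`. [folklore] -/
theorem ω₁_div_notMem (L : PeriodPair) {q : ℕ} (hq : 2 ≤ q) : L.ω₁ / q ∉ L.lattice := by
  have h := L.natMul_ω₁_div_notMem (n := q) (j := 1) one_pos (by omega)
  simpa using h

/-- `ω₂/q ∉ Λ` for `q ≥ 2`. [folklore] -/
theorem ω₂_div_notMem (L : PeriodPair) {q : ℕ} (hq : 2 ≤ q) : L.ω₂ / q ∉ L.lattice := by
  intro h
  have h' : ((0 : ℚ) : ℂ) * L.ω₁ + ((1 / q : ℚ) : ℂ) * L.ω₂ ∈ L.lattice := by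
    push_cast
    simpa [div_eq_inv_mul] using h
  rw [PeriodPair.mul_ω₁_add_mul_ω₂_mem_lattice] at h'
  have hden : ((1 / q : ℚ)).den = q := by
    rw [one_div, Rat.inv_natCast_den, if_neg (by omega)]
  omega

/-- `q · (ω₁/q) ∈ Λ`. [folklore] -/
theorem natCast_mul_ω₁_div_mem (L : PeriodPair) {q : ℕ} (hq : q ≠ 0) :
    (q : ℂ) * (L.ω₁ / q) ∈ L.lattice := by
  rw [mul_div_cancel₀ _ (by exact_mod_cast hq : (q : ℂ) ≠ 0)]
  exact L.ω₁_mem_lattice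

/-- `q · (ω₂/q) ∈ Λ`. [folklore] -/
theorem natCast_mul_ω₂_div_mem (L : PeriodPair) {q : ℕ} (hq : q ≠ 0) :
    (q : ℂ) * (L.ω₂ / q) ∈ L.lattice := by
  rw [mul_div_cancel₀ _ (by exact_mod_cast hq : (q : ℂ) ≠ 0)]
  exact L.ω₂_mem_lattice

/-- The four generators `℘(ω₁/q), ℘'(ω₁/q)/2, ℘(ω₂/q), ℘'(ω₂/q)/2`. [folklore] -/
def divisionGens (L : PeriodPair) (q : ℕ) : Set ℂ :=
  {℘[L] (L.ω₁ / q), ℘'[L] (L.ω₁ / q) / 2, ℘[L] (L.ω₂ / q), ℘'[L] (L.ω₂ / q) / 2}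

/-- The generators are division values. [folklore] -/
theorem divisionGens_subset (L : PeriodPair) {q : ℕ} (hq : 2 ≤ q) :
    divisionGens L q ⊆ divisionValues L q := by
  have h1 := natCast_mul_ω₁_div_mem L (q := q) (by omega)
  have h2 := natCast_mul_ω₂_div_mem L (q := q) (by omega)
  intro c hc
  simp only [divisionGens, Set.mem_insert_iff, Set.mem_singleton_iff] at hc
  rcases hc with rfl | rfl | rfl | rfl
  · exact weierstrassP_mem_divisionValues (ω₁_div_notMem L hq) h1
  · exact derivWeierstrassP_div_two_mem_divisionValues (ω₁_div_notMem L hq) h1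
  · exact weierstrassP_mem_divisionValues (ω₂_div_notMem L hq) h2
  · exact derivWeierstrassP_div_two_mem_divisionValues (ω₂_div_notMem L hq) h2

section Model

variable {F : Type} [Field F] [Algebra F ℂ]
variable {E : WeierstrassCurve F} {L : PeriodPair} (hE : E.baseChange ℂ = L.curve)

/-! ### Points with coordinates in an intermediate field -/

/-- The points of `E_Λ(ℂ)` coming from `E(K)`, `K` an intermediate field of `ℂ/F`. [folklore] -/
def latticePointsOver (K : IntermediateField F ℂ) : AddSubgroup L.curve.toAffine.Point :=
  ((Affine.Point.congrEquiv hE).toAddMonoidHom.comp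
    (Affine.Point.map (W' := E) (K.val) :
      (E.baseChange K).toAffine.Point →+ (E.baseChange ℂ).toAffine.Point)).range

/-- A point with coordinates in `K` lies in `latticePointsOver K`. [folklore] -/
theorem some_mem_latticePointsOver (K : IntermediateField F ℂ) {x y : ℂ}
    (h : L.curve.toAffine.Nonsingular x y) (hx : x ∈ K) (hy : y ∈ K) :
    Affine.Point.some x y h ∈ latticePointsOver hE K := by
  have h' : (E.baseChange ℂ).toAffine.Nonsingular (K.val ⟨x, hx⟩) (K.val ⟨y, hy⟩) := by
    rw [hE]; exact h
  have h'' := (E.toAffine.baseChange_nonsingular (K.val).injective ⟨x, hx⟩ ⟨y, hy⟩).mp h'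
  refine ⟨Affine.Point.some ⟨x, hx⟩ ⟨y, hy⟩ h'', ?_⟩
  change Affine.Point.congrEquiv hE (Affine.Point.map (W' := E) K.val (Affine.Point.some _ _ h'')) = _
  erw [Affine.Point.map_some (K.val) h'']
  rw [Affine.Point.congrEquiv_some]
  rfl

/-- The coordinates of a point of `latticePointsOver K` lie in `K`. [folklore] -/
theorem mem_of_some_mem_latticePointsOver (K : IntermediateField F ℂ) {x y : ℂ}
    {h : L.curve.toAffine.Nonsingular x y} (hP : Affine.Point.some x y h ∈ latticePointsOver hE K) :
    x ∈ K ∧ y ∈ K := by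
  obtain ⟨R, hR⟩ := hP
  rcases R with _ | ⟨x', y', h'⟩
  · change Affine.Point.congrEquiv hE (Affine.Point.map (W' := E) K.val 0) = _ at hR
    rw [map_zero, Affine.Point.congrEquiv_zero] at hR
    exact absurd hR.symm (WeierstrassCurve.Affine.Point.some_ne_zero _)
  · change Affine.Point.congrEquiv hE (Affine.Point.map (W' := E) K.val (Affine.Point.some _ _ h')) = _
      at hR
    erw [Affine.Point.map_some (K.val) h'] at hR
    rw [Affine.Point.congrEquiv_some] at hR
    simp only [Affine.Point.some.injEq] at hR
    obtain ⟨hx, hy⟩ := hR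
    exact ⟨hx ▸ x'.2, hy ▸ y'.2⟩

/-! ### Two generators -/

/-- **`F(E_Λ[q]) = F(℘(ω₁/q), ℘'(ω₁/q)/2, ℘(ω₂/q), ℘'(ω₂/q)/2)`**: every `q`-division point is
`aπ(ω₁/q) + bπ(ω₂/q)` and `E(K)` is a subgroup for every field `K ⊇ F`.
[cite: SilvermanAEC2009, III.2.3 (E(K) is a subgroup of E(K̄))] -/
theorem adjoin_divisionValues_eq (hE : E.baseChange ℂ = L.curve) {q : ℕ} (hq : 2 ≤ q) :
    IntermediateField.adjoin F (divisionValues L q) =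
      IntermediateField.adjoin F (divisionGens L q) := by
  refine le_antisymm ?_ (IntermediateField.adjoin.mono F _ _ (divisionGens_subset L hq))
  set K := IntermediateField.adjoin F (divisionGens L q) with hK
  rw [IntermediateField.adjoin_le_iff]
  -- the two generators lie in `latticePointsOver K`
  have hq0 : (q : ℂ) ≠ 0 := by exact_mod_cast (show q ≠ 0 by omega)
  have hgen : ∀ c ∈ divisionGens L q, c ∈ K := fun c hc => IntermediateField.subset_adjoin F _ hc
  have hP : L.toPoint (L.ω₁ / q) ∈ latticePointsOver hE K := by
    rw [toPoint_of_notMem (ω₁_div_notMem L hq)]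
    exact some_mem_latticePointsOver hE K _ (hgen _ (by simp [divisionGens])) (hgen _ (by simp [divisionGens]))
  have hQ : L.toPoint (L.ω₂ / q) ∈ latticePointsOver hE K := by
    rw [toPoint_of_notMem (ω₂_div_notMem L hq)]
    exact some_mem_latticePointsOver hE K _ (hgen _ (by simp [divisionGens])) (hgen _ (by simp [divisionGens]))
  -- every division point is `aP + bQ`
  rintro c ⟨w, hw, hqw, hc⟩
  obtain ⟨a, b, hab⟩ := PeriodPair.mem_lattice.mp hqw
  have hw' : w = a * (L.ω₁ / q) + b * (L.ω₂ / q) := by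
    apply mul_left_cancel₀ hq0
    rw [← hab]
    field_simp
  have hmem : L.toPoint w ∈ latticePointsOver hE K := by
    rw [hw', ← toPointHom_apply (toPoint_add_holds (L := L)), map_add, ← zsmul_eq_mul,
      ← zsmul_eq_mul, map_zsmul, map_zsmul, toPointHom_apply, toPointHom_apply]
    exact add_mem (zsmul_mem hP a) (zsmul_mem hQ b)
  rw [toPoint_of_notMem hw] at hmem
  obtain ⟨hx, hy⟩ := mem_of_some_mem_latticePointsOver hE K hmem
  rcases hc with rfl | rfl
  · exact hx
  · exact hy

/-! ### The degree bound -/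

omit [Algebra F ℂ] in
/-- `[F(x, y) : F] ≤ 2 deg p` when `p(x) = 0` (`p ≠ 0`) and `y² = r(x)` with `r ∈ F[X]`.
[folklore] -/
theorem finrank_adjoin_pair_le {M : Type} [Field M] [Algebra F M] {x y : M} {p r : F[X]}
    (hp : p ≠ 0) (hpx : aeval x p = 0) (hy : y ^ 2 = aeval x r) :
    Module.finrank F (IntermediateField.adjoin F ({x, y} : Set M)) ≤ 2 * p.natDegree := by
  have hxalg : IsAlgebraic F x := ⟨p, hp, hpx⟩
  have hxint : _root_.IsIntegral F x := hxalg.isIntegral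
  set K₁ := IntermediateField.adjoin F ({x} : Set M) with hK₁
  haveI : FiniteDimensional F K₁ := IntermediateField.adjoin.finiteDimensional hxint
  -- `[F(x) : F] ≤ deg p`
  have h1 : Module.finrank F K₁ ≤ p.natDegree := by
    rw [hK₁, IntermediateField.adjoin.finrank hxint]
    exact Polynomial.natDegree_le_natDegree (minpoly.degree_le_of_ne_zero F x hp hpx)
  -- `y` is quadratic over `F(x)`
  let x' : K₁ := ⟨x, IntermediateField.mem_adjoin_simple_self F x⟩
  let c : K₁ := aeval x' r
  have hc : (c : M) = aeval x r := by
    change algebraMap K₁ M (aeval x' r) = _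
    rw [← Polynomial.aeval_algebraMap_apply]
    rfl
  have hy' : aeval y (X ^ 2 - C c : K₁[X]) = 0 := by
    simp only [map_sub, map_pow, aeval_X, aeval_C]
    rw [show algebraMap K₁ M c = (c : M) from rfl, hc, hy, sub_self]
  have hmonic : (X ^ 2 - C c : K₁[X]).Monic := Polynomial.monic_X_pow_sub_C c two_ne_zero
  have hyint : _root_.IsIntegral K₁ y := ⟨_, hmonic, by rwa [← aeval_def]⟩
  have h2 : Module.finrank K₁ (IntermediateField.adjoin K₁ ({y} : Set M)) ≤ 2 := by
    rw [IntermediateField.adjoin.finrank hyint]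
    have := Polynomial.natDegree_le_natDegree (minpoly.min K₁ y hmonic hy')
    simpa [Polynomial.natDegree_X_pow_sub_C] using this
  -- tower
  haveI : FiniteDimensional K₁ (IntermediateField.adjoin K₁ ({y} : Set M)) :=
    IntermediateField.adjoin.finiteDimensional hyint
  haveI : Module.Free K₁ (IntermediateField.adjoin K₁ ({y} : Set M)) := Module.Free.of_divisionRing _ _
  haveI : Module.Free F K₁ := Module.Free.of_divisionRing _ _
  have htower := Module.finrank_mul_finrank F K₁ (IntermediateField.adjoin K₁ ({y} : Set M))
  have hrs : (IntermediateField.adjoin K₁ ({y} : Set M)).restrictScalars F =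
      IntermediateField.adjoin F ({x, y} : Set M) := by
    rw [hK₁]; exact IntermediateField.adjoin_simple_adjoin_simple F x y
  rw [← hrs]
  change Module.finrank F (IntermediateField.adjoin K₁ ({y} : Set M)) ≤ _
  rw [← htower]
  calc Module.finrank F K₁ * Module.finrank K₁ (IntermediateField.adjoin K₁ ({y} : Set M))
      ≤ p.natDegree * 2 := Nat.mul_le_mul h1 h2
    _ = 2 * p.natDegree := mul_comm _ _

/-- `[F(℘(w), ℘'(w)/2) : F] ≤ 2(q² - 1)` for a `q`-division point `w`. [cite: SilvermanAEC2009,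
Exercise 3.7(b),(f)] -/
theorem finrank_adjoin_divisionPoint_le [CharZero F] (hE : E.baseChange ℂ = L.curve) {q : ℕ}
    (hq : q ≠ 0) {w : ℂ} (hw : w ∉ L.lattice) (hqw : (q : ℂ) * w ∈ L.lattice) :
    Module.finrank F (IntermediateField.adjoin F ({℘[L] w, ℘'[L] w / 2} : Set ℂ)) ≤
      2 * (q ^ 2 - 1) := by
  have hEmap : E.map (algebraMap F ℂ) = L.curve := hE
  have hp0 : E.ΨSq (q : ℤ) ≠ 0 := by
    intro h0
    have := E.natDegree_ΨSq (n := (q : ℤ)) (by exact_mod_cast hq)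
    rw [h0, Polynomial.natDegree_zero] at this
    -- `q² - 1` need not be `0`, but the coefficient lemma gives the contradiction directly
    have h1 := E.coeff_ΨSq_ne_zero (n := (q : ℤ)) (by exact_mod_cast hq)
    rw [h0, Polynomial.coeff_zero] at h1
    exact h1 rfl
  have hpx : aeval (℘[L] w) (E.ΨSq (q : ℤ)) = 0 :=
    PeriodPair.aeval_weierstrassP_ΨSq_eq_zero hEmap hw (by exact_mod_cast hqw)
  -- the Weierstrass equation: `(℘'/2)² = ℘³ + a₄ ℘ + a₆`
  have heq := (L.equation_weierstrassP hw)
  rw [WeierstrassCurve.Affine.equation_iff] at heq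
  have hy : (℘'[L] w / 2) ^ 2 = aeval (℘[L] w) (X ^ 3 + C E.a₄ * X + C E.a₆ : F[X]) := by
    have ha₁ : L.curve.toAffine.a₁ = 0 := rfl
    have ha₂ : L.curve.toAffine.a₂ = 0 := rfl
    have ha₃ : L.curve.toAffine.a₃ = 0 := rfl
    have ha₄ : algebraMap F ℂ E.a₄ = L.curve.toAffine.a₄ := by
      rw [← hEmap]; rfl
    have ha₆ : algebraMap F ℂ E.a₆ = L.curve.toAffine.a₆ := by
      rw [← hEmap]; rfl
    simp only [map_add, map_mul, map_pow, aeval_X, aeval_C, ha₄, ha₆]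
    rw [ha₁, ha₂, ha₃] at heq
    linear_combination heq
  have h := finrank_adjoin_pair_le (F := F) hp0 hpx hy
  rw [E.natDegree_ΨSq (n := (q : ℤ)) (by exact_mod_cast hq), Int.natAbs_natCast] at h
  exact h

/-- **`[F(E_Λ[q]) : F] ≤ (2(q² - 1))²`**: the field of `q`-division values has degree at most
`4(q² - 1)² ≤ 4q⁴` over `F`. [cite: SilvermanAEC2009, Exercise 3.7 and III.2.3; Baker1975, p. 62] -/
theorem finrank_adjoin_divisionValues_le [CharZero F] (hE : E.baseChange ℂ = L.curve) {q : ℕ}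
    (hq : 2 ≤ q) :
    Module.finrank F (IntermediateField.adjoin F (divisionValues L q)) ≤
      (2 * (q ^ 2 - 1)) ^ 2 := by
  rw [adjoin_divisionValues_eq hE hq]
  have hq0 : q ≠ 0 := by omega
  have h1 := natCast_mul_ω₁_div_mem L (q := q) hq0
  have h2 := natCast_mul_ω₂_div_mem L (q := q) hq0
  have hsplit : divisionGens L q =
      ({℘[L] (L.ω₁ / q), ℘'[L] (L.ω₁ / q) / 2} : Set ℂ) ∪ {℘[L] (L.ω₂ / q), ℘'[L] (L.ω₂ / q) / 2} := by
    ext c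
    simp only [divisionGens, Set.mem_insert_iff, Set.mem_singleton_iff, Set.mem_union]
    tauto
  rw [hsplit, IntermediateField.adjoin_union]
  calc _ ≤ _ := IntermediateField.finrank_sup_le _ _
    _ ≤ (2 * (q ^ 2 - 1)) * (2 * (q ^ 2 - 1)) :=
        Nat.mul_le_mul (finrank_adjoin_divisionPoint_le hE hq0 (ω₁_div_notMem L hq) h1)
          (finrank_adjoin_divisionPoint_le hE hq0 (ω₂_div_notMem L hq) h2)
    _ = (2 * (q ^ 2 - 1)) ^ 2 := (sq _).symm

/-- The field of `q`-division values is a finite extension of `F`. [folklore] -/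
theorem finiteDimensional_adjoin_divisionValues [CharZero F] (hE : E.baseChange ℂ = L.curve)
    {q : ℕ} (hq : 2 ≤ q) :
    FiniteDimensional F (IntermediateField.adjoin F (divisionValues L q)) := by
  have h := finrank_adjoin_divisionValues_le hE hq
  rw [adjoin_divisionValues_eq hE hq] at h ⊢
  -- the four generators are integral, so the adjoin is finite-dimensional
  haveI : Finite (divisionGens L q) :=
    ((((Set.finite_singleton _).insert _).insert _).insert _).to_subtype
  apply IntermediateField.finiteDimensional_adjoin
  intro c hc
  have hq0 : q ≠ 0 := by omega
  have hEmap : E.map (algebraMap F ℂ) = L.curve := hE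
  have hint : ∀ w : ℂ, w ∉ L.lattice → (q : ℂ) * w ∈ L.lattice →
      _root_.IsIntegral F (℘[L] w) ∧ _root_.IsIntegral F (℘'[L] w / 2) := by
    intro w hw hqw
    have hp0 : E.ΨSq (q : ℤ) ≠ 0 := by
      intro h0
      have h1 := E.coeff_ΨSq_ne_zero (n := (q : ℤ)) (by exact_mod_cast hq0)
      rw [h0, Polynomial.coeff_zero] at h1
      exact h1 rfl
    have hxalg : IsAlgebraic F (℘[L] w) :=
      ⟨_, hp0, PeriodPair.aeval_weierstrassP_ΨSq_eq_zero hEmap hw (by exact_mod_cast hqw)⟩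
    have hx : _root_.IsIntegral F (℘[L] w) := hxalg.isIntegral
    refine ⟨hx, ?_⟩
    -- `℘'/2` is integral over `F(℘)`, hence over `F`
    have heq := (L.equation_weierstrassP hw)
    rw [WeierstrassCurve.Affine.equation_iff] at heq
    have ha₁ : L.curve.toAffine.a₁ = 0 := rfl
    have ha₂ : L.curve.toAffine.a₂ = 0 := rfl
    have ha₃ : L.curve.toAffine.a₃ = 0 := rfl
    rw [ha₁, ha₂, ha₃] at heq
    have hsq : (℘'[L] w / 2) ^ 2 =
        ℘[L] w ^ 3 + L.curve.toAffine.a₄ * ℘[L] w + L.curve.toAffine.a₆ := by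
      linear_combination heq
    have ha₄ : _root_.IsIntegral F L.curve.toAffine.a₄ := by
      rw [← hEmap]; exact isIntegral_algebraMap
    have ha₆ : _root_.IsIntegral F L.curve.toAffine.a₆ := by
      rw [← hEmap]; exact isIntegral_algebraMap
    have hrhs : _root_.IsIntegral F (℘[L] w ^ 3 + L.curve.toAffine.a₄ * ℘[L] w + L.curve.toAffine.a₆) :=
      ((hx.pow 3).add (ha₄.mul hx)).add ha₆
    exact _root_.IsIntegral.of_pow two_pos (hsq ▸ hrhs)
  have h1 := natCast_mul_ω₁_div_mem L (q := q) hq0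
  have h2 := natCast_mul_ω₂_div_mem L (q := q) hq0
  simp only [divisionGens, Set.mem_insert_iff, Set.mem_singleton_iff] at hc
  rcases hc with rfl | rfl | rfl | rfl
  · exact (hint _ (ω₁_div_notMem L hq) h1).1
  · exact (hint _ (ω₁_div_notMem L hq) h1).2
  · exact (hint _ (ω₂_div_notMem L hq) h2).1
  · exact (hint _ (ω₂_div_notMem L hq) h2).2

/-- **Roots of unity and division values together**: the field generated over `F` by the
`q`-division values and `e^{2πi/q}` is the field of `q`-division values, of degree `≤ 4q⁴`.
[cite: SilvermanAEC2009, Cor. III.8.1.1; Baker1975, p. 62] -/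
theorem finrank_adjoin_divisionValues_insert_exp_le [CharZero F] (hE : E.baseChange ℂ = L.curve)
    {q : ℕ} (hq : 2 ≤ q) :
    IntermediateField.adjoin F (insert (Complex.exp (2 * Real.pi * Complex.I / q))
        (divisionValues L q)) = IntermediateField.adjoin F (divisionValues L q) ∧
      Module.finrank F (IntermediateField.adjoin F (divisionValues L q)) ≤ 4 * q ^ 4 := by
  constructor
  · refine le_antisymm ?_ (IntermediateField.adjoin.mono F _ _ (Set.subset_insert _ _))
    rw [IntermediateField.adjoin_le_iff, Set.insert_subset_iff]
    exact ⟨exp_two_pi_I_div_mem_adjoin_divisionValues hE (by omega),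
      IntermediateField.subset_adjoin F _⟩
  · calc _ ≤ (2 * (q ^ 2 - 1)) ^ 2 := finrank_adjoin_divisionValues_le hE hq
      _ ≤ (2 * q ^ 2) ^ 2 := Nat.pow_le_pow_left (Nat.mul_le_mul_left 2 (Nat.sub_le _ _)) 2
      _ = 4 * q ^ 4 := by ring

end Model

end Literature.NumberTheory.EllipticCurves
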